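/-
Origin: expansion seat `planner-pub-hodgecm-mc-axioms-1-g14-0`, handover #W230 2026-08-20T15:53:55Z md5 a49cc4fccef5 (PKG 016494812a29 → a49cc4fccef5; 447 l.; MECHANICAL (iib-R) rewrite v3.1 of the PKG file as it stands (158 token edits; rules R1x2+RX[h₂]x156)) (`HOME/mc/pub-hodgecm-mc-axioms-1-g14/revendor/kit-r55/stage55/HodgeCM/Model/Binders/Real34PinsTotalK.lean`, md5 a49cc4fccef5, 447 lines);
landed by the gen-22 packager (p-g22) in gate run 55 REPLACES the earlier landed copy of `HodgeCM/Model/Binders/Real34PinsTotalK.lean` (seat copy carried the packager Origin header of an earlier run (stripped)).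
-/
/-
Origin: speedrun cell pub-hodgecm, MODEL-CONSTRUCTION sub-cell, unit pub-hodgecm-mc-binder-1-g10 (BINDER PROVER, gen 10; node B2-meet,
BINDER-OWNERS row 15 `real34` at the TOTAL pins of record), seat prover-pub-hodgecm-mc-binder-1-g10-0, 2026-08-20.
Target in PKG: HodgeCM/Model/Binders/Real34PinsTotalK.lean (NEW additive leaf, RUN 39+; imports #26 `Binders/Gen12PinsTotal` (RUN 37),
mc-discharge-1 D-6 `Binders/Real34GenMem` r3 (RUN 37), binder-1-g6 #6 `Binders/GramWRegime` (RUN 36)).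
KERNEL ONLY: 0 records of published theorems, nothing cited, 0 `def … : Prop`, ONE hypothesis record (data + two Props), MODEL-N ±0, E unchanged.
Nothing here is a claim of the manuscripts under adjudication.
-/
import Summits.HodgeConjecture.HodgeCM.Model.Binders.Gen12PinsTotal
import Summits.HodgeConjecture.HodgeCM.Model.Binders.Real34GenMem
import Summits.HodgeConjecture.HodgeCM.Model.Binders.GramWRegime

/-!
# Row `real34` at the total pins: the residual is the (K34) K-TYPE DATUM (and the (L3) pin field)

#26 `Binders/Gen12PinsTotal` left row 15 (`real34_totalE`) modulo the per-context hypothesis record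
`Real34TotalResidual {hcorr, gen_mem, hU₂, hU₃}`.  This leaf discharges three of the four fields STRUCTURALLY:

* `hU₂`/`hU₃` (C3₂,₃) are consequences of E's OWN binders `hLiu` (theta classes CM-isotypic up to inflation) and
  `h31 : U.Fact_cmInflation` — glue-1's `Model.thetaSub_of_fact` (E revision 8) at the pins: **`Gen12Pins.hU_total`**;
* `gen_mem` (K34) is mc-discharge-1's junction theorem `Real34Loc.gen_mem_of_kType` (D-6) at the pinned record
  `J := Real34Loc.ofThetaSat …` with EVERY junction hypothesis discharged at the total pins — `hW` (binder-1-g6 `GramWRegime`,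
  from the good context), `H := SeesawHyp34.ofTotal hdef` (#26, period-1's (SS₃₄)), `hRep` for MATCHED characters
  (g8 #19 r2 `Real34Loc.ofThetaSat_rep_thetaGenElt`, the matching of the (34)-torus index characters read from (N1)₂,₃
  `((S V c).P k).w = archWeight L (μ c k)`, k = 2, 3) — leaving EXACTLY the K-type datum `Real34KTypeDatum {P, hP, hdec}`
  (PerL Lemma 3.5 (34), K-type half: a dense set of test functions each a finite sum of wedge tensors of frame vectors of
  admissible situations of lines 2, 3): **`Real34Loc.gen_mem_ofThetaSat_of_kTypeDatum`** (generic pins), **`Gen12Pins.gen_mem_totalK`**;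
* `hcorr` (L3) stays a hypothesis HERE (it is the pin field `ThetaAdelicSide.rat_split_level` of theta-3's RUN-38 re-cut (A)
  `Model/ThetaSpaceInputPin`; discharged in the RUN-38-world sibling leaf `Binders/Real34PinsTotalKR38`).

DENSITY-FREE VARIANT (r2, § 1′/§ 3′): the (34) generator `ϑ₃₄(χ, ·)` only sees a test function through its own value on it, so the
decomposition may be asked χ-BY-χ and UP TO `ϑ₃₄(χ, ·)`-EQUIVALENCE: `Real34KTypeDatumT {hdecT : ∀ χ Φ, ∃ Φ', ϑ χ Φ = ϑ χ Φ' ∧ Φ'.1 = Σ wedges}`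
(no dense set, no topology; inhabit e.g. with `Φ' :=` the `(K_∞ × T₃₄(ℝ))`-isotypic Hermite-block projection of `Φ`, a FINITE Hermite sum at
every archimedean place), giving `gen_mem` with `span` in place of its closure: **`Real34Loc.gen_mem_ofThetaSat_of_kTypeDatumT`**,
**`Gen12Pins.gen_mem_totalKT`**, **`real34_totalKT`** / **`real34_totalKTE`** (same hypotheses, `D` replaced by `DT`).

Headline: **`Gen12Pins.real34_totalK`** / **`real34_totalKE`** — E's binder `real34` VERBATIM at the total pins of record from
E's own `hpc hcup hph h31 hLiu`, the line-weight read-back `hAw` (rfl at theta-3's (E1) pin `archLineInputOf`, cf. #27), the (L3)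
family `hcorr`, and ONE K-type datum per good sextic context.
-/

set_option autoImplicit false

noncomputable section

open MeasureTheory NumberField MulAction
open scoped Matrix InnerProductSpace

namespace HodgeCM.Model

open HodgeCM HodgeCM.Universe HodgeCM.Adelic
open Literature.NumberTheory.Weil1964
open Literature.NumberTheory.Automorphic (piSchwartzBruhat)
open Literature.NumberTheory.Automorphic.UnitaryGroup (archIsotropy archIsotropyProj archKappa archSectionU21CM)
open Literature.NumberTheory.GelbartRogawski1991.UnitaryDualPair
open Literature.RepresentationTheory.HeisenbergGroup
open Literature.Geometry.ComplexHyperbolic.BallModel (U21 x₀ Jac)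
open Literature.AlgebraicGeometry.HodgeTheory
open Literature.NumberTheory.Automorphic.PicardCM
open Literature.NumberTheory.Transcendental (Arapura2012_Cor_15_4_6)
open HodgeCM.CMTypeOps (inflate)
open HodgeCM.Model.ThetaSpace
open HodgeCM.Model.ArchSideTerm
open NumberField.SeesawTorus (charFst charSnd mem_allowedChars)

/-! ## 1. Generic pins: the K-type datum and (K34) at `Real34Loc.ofThetaSat` from it -/

section Generic

variable (hHD : exists_isReal_hodgeModel) (hI : hodgePQ_independent_of_hodgeModel)
  (h₁ : BallQuotientUniformised)  (h₃ : CMAbelianVarietyRealised)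
variable (h : Bool) (hA : Arapura2012_Cor_15_4_6)
  (W : ∀ {L : CMField} {ι₁ : L →+* ℂ} (V : HermSpace3 L ι₁) (c : SeesawCtx L), WmInput V c.D)
  (S : ∀ {L : CMField} {ι₁ : L →+* ℂ} (V : HermSpace3 L ι₁) (c : SeesawCtx L), ThetaAdelicSide V c)
  (μ : ∀ {L : CMField}, SeesawCtx L → Fin 4 → InfinitePlace L → ℤ)

variable {L : CMField} {ι₁ : L →+* ℂ} (V : HermSpace3 L ι₁) (c : SeesawCtx L) (hV : IsAnisotropic L V.Hm)

local notation3 "𝕏" => pinX hHD hI h₁ h₃ S V c hV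

/-- **The (K34) K-TYPE DATUM of a context** (PerL Lemma 3.5, (34) half, K-type content — mc-discharge-1 D-6's hypotheses `P hP hdec`
of `Real34Loc.gen_mem_of_kType`, packaged): a DENSE set `P ⊆ 𝒮^κ` of test functions each of which is a finite linear combination of
WEDGE TENSORS `τ φ₂⁰ φ₃¹ − τ φ₂¹ φ₃⁰` of frame vectors (`toThetaTop φⱼᵃ = jⱼ (ιⱼ e_a)`) of `adm`-admissible `K`-type situations of lines
`2`, `3` at common levels.  A HYPOTHESIS record (one datum + two properties); nothing asserted. -/
structure Real34KTypeDatum (H : SeesawHyp34 W S V c)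
    (adm : ∀ (Γ : Level V) (k : Fin 4), KTypeSituation ((𝕏).P k) ((𝕏).ιinf Γ) ((𝕏).Δ Γ) (𝕏).κ₁ (𝕏).τ₁ → Prop) where
  /-- the dense set of decomposable test functions -/
  P : Set ((pinT hHD hI h₁ h₃ h hA W S μ).SK V c)
  /-- density in `𝒮^κ` -/
  hP : Dense P
  /-- every member is a finite sum of wedge tensors of frame vectors of admissible situations of lines `2`, `3` -/
  hdec : ∀ Φ ∈ P, ∃ (n : ℕ) (Γ' : Fin n → Level V)
      (Sit₂ : ∀ i, KTypeSituation ((𝕏).P 2) ((𝕏).ιinf (Γ' i)) ((𝕏).Δ (Γ' i)) (𝕏).κ₁ (𝕏).τ₁)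
      (j₂ : ∀ i, {j : (Sit₂ i).E →ₗ[ℂ] ((𝕏).P 2).weilDatum.ThetaTop // ((𝕏).P 2).kernelDatum.IsThetaEquivariant (Sit₂ i).κ (Sit₂ i).σ j})
      (Sit₃ : ∀ i, KTypeSituation ((𝕏).P 3) ((𝕏).ιinf (Γ' i)) ((𝕏).Δ (Γ' i)) (𝕏).κ₁ (𝕏).τ₁)
      (j₃ : ∀ i, {j : (Sit₃ i).E →ₗ[ℂ] ((𝕏).P 3).weilDatum.ThetaTop // ((𝕏).P 3).kernelDatum.IsThetaEquivariant (Sit₃ i).κ (Sit₃ i).σ j})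
      (φ₂ φ₃ : Fin n → Fin 2 → piSchwartzBruhat (𝕏).K (Fin 3)) (a : Fin n → ℂ),
      (∀ i, adm (Γ' i) 2 (Sit₂ i) ∧ j₂ i ∈ (Sit₂ i).𝓙 ∧ adm (Γ' i) 3 (Sit₃ i) ∧ j₃ i ∈ (Sit₃ i).𝓙) ∧
      (∀ i a', ((𝕏).P 2).weilDatum.toThetaTop (φ₂ i a') = (j₂ i).1 ((Sit₂ i).ι (LinearMap.proj a'))) ∧
      (∀ i a', ((𝕏).P 3).weilDatum.toThetaTop (φ₃ i a') = (j₃ i).1 ((Sit₃ i).ι (LinearMap.proj a'))) ∧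
      Φ.1 = ∑ i, a i • (H.τ (φ₂ i 0) (φ₃ i 1) - H.τ (φ₂ i 1) (φ₃ i 0))

/-- **(K34) at the pinned record `Real34Loc.ofThetaSat` from the K-type datum** — D-6's `Real34Loc.gen_mem_of_kType` with its `hRep`
DISCHARGED: at `J := Real34Loc.ofThetaSat … hGfin hcorr` (`Rep Γ i G := G ∈ span (thetaGen Γ i adm₃₄)`) the generating theta forms
`θ(j, χ'⁻¹)` of `adm₃₄`-admissible situations are `Rep`-admissible for weight-MATCHED `χ'` (g8 `Real34Loc.ofThetaSat_rep_thetaGenElt`),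
and the (34)-torus index characters `χ : (t34 V c).X` ARE matched on both factors once the line weights of `S` at `k = 2, 3` are the
archimedean weights of `μ` ((N1)₂,₃: `WeilPairData.residualType_iff_hasArchType_neg` + `mem_allowedChars` + `d34Of_m₁/m₂`). -/
theorem Real34Loc.gen_mem_ofThetaSat_of_kTypeDatum
    (hGfin : ∀ kf : V.adelicFin, finTranslate V hV kf ∈ (S V c).Gfin)
    (hcorr : ∀ (Γ : Level V), ∀ δ ∈ levelImage hHD hI h₁ h₃ Γ hV,
      ∃ x : (V.latticeModel printFact_unitaryCompact_holds).G, x ∈ satLevelRegimeOf V hV Γ.K ∧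
        (S V c).ιinf δ * x ∈ (V.latticeModel printFact_unitaryCompact_holds).Γ ∧ ∀ y : U21, Commute x ((S V c).ιinf y))
    (hW : IsAnisotropic L c.D.gramW) (H : SeesawHyp34 W S V c)
    (h2 : ((S V c).P 2).w = ⇑(archWeight L (μ c 2))) (h3 : ((S V c).P 3).w = ⇑(archWeight L (μ c 3)))
    (D : Real34KTypeDatum hHD hI h₁ h₃ h hA W S μ V c hV H (adm₃₄ hHD hI h₁ h₃ (S V c) hV)) :
    ∀ (χ : ((pinT hHD hI h₁ h₃ h hA W S μ).t34 V c).X) (Φ : (pinT hHD hI h₁ h₃ h hA W S μ).SK V c),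
      ((pinT hHD hI h₁ h₃ h hA W S μ).t34 V c).ϑ χ Φ ∈
        (Submodule.span ℂ (Real34Loc.ofThetaSat hHD hI h₁ h₃ h hA W S μ V c hV hGfin hcorr).wset).topologicalClosure := by
  refine Real34Loc.gen_mem_of_dense hHD hI h₁ h₃ h hA W S μ V c hV _ D.hP fun χ Φ hΦ => ?_
  obtain ⟨n, Γ', Sit₂, j₂, Sit₃, j₃, φ₂, φ₃, a, hadm, hφ₂, hφ₃, hΦ1⟩ := D.hdec Φ hΦ
  rw [t34_ϑ_eq_smul_sum_realise_wedge₂ hHD hI h₁ h₃ h hA W S μ V c hV hW H Γ' Sit₂ j₂ Sit₃ j₃ φ₂ φ₃ hφ₂ hφ₃ a χ Φ hΦ1]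
  refine Submodule.smul_mem _ _ (Submodule.sum_mem _ fun i _ => Submodule.smul_mem _ _ (Submodule.subset_span ?_))
  have hχ := (mem_allowedChars _ _ _).1 χ.2
  exact (Real34Loc.ofThetaSat hHD hI h₁ h₃ h hA W S μ V c hV hGfin hcorr).realise_wedge₂_mem_wset
    (Real34Loc.ofThetaSat_rep_thetaGenElt hHD hI h₁ h₃ h hA W S μ V c hV hGfin hcorr (Γ' i) 2 (Sit₂ i) (hadm i).1
      (j₂ i) (hadm i).2.1 (charFst χ.1)
      ((((S V c).P 2).residualType_iff_hasArchType_neg h2 (charFst χ.1)).2 (by simpa only [d34Of_m₁] using hχ.1)))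
    (Real34Loc.ofThetaSat_rep_thetaGenElt hHD hI h₁ h₃ h hA W S μ V c hV hGfin hcorr (Γ' i) 3 (Sit₃ i) (hadm i).2.2.1
      (j₃ i) (hadm i).2.2.2 (charSnd χ.1)
      ((((S V c).P 3).residualType_iff_hasArchType_neg h3 (charSnd χ.1)).2 (by simpa only [d34Of_m₂] using hχ.2)))

/-! ### 1′. The density-free, character-wise variant -/

/-- **The (K34) K-type datum, CHARACTER-WISE and up to `ϑ₃₄(χ, ·)`-equivalence** (density-free variant of `Real34KTypeDatum`): for every
(34)-torus index character `χ` and every test function `Φ ∈ 𝒮^κ` SOME test function `Φ'` with the same (34) generator `ϑ₃₄(χ, Φ') = ϑ₃₄(χ, Φ)` is a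
finite linear combination of wedge tensors of frame vectors of `adm`-admissible situations of lines `2`, `3`.  (Intended inhabitant: `Φ' :=` the
`K_∞ × T₃₄(ℝ)`-isotypic Hermite-block projection of `Φ`, a finite Hermite sum at every archimedean place.)  A HYPOTHESIS record; nothing asserted. -/
structure Real34KTypeDatumT (H : SeesawHyp34 W S V c)
    (adm : ∀ (Γ : Level V) (k : Fin 4), KTypeSituation ((𝕏).P k) ((𝕏).ιinf Γ) ((𝕏).Δ Γ) (𝕏).κ₁ (𝕏).τ₁ → Prop) where
  /-- every generator value is that of a finite sum of wedge tensors of frame vectors of admissible situations of lines `2`, `3` -/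
  hdecT : ∀ (χ : ((pinT hHD hI h₁ h₃ h hA W S μ).t34 V c).X) (Φ : (pinT hHD hI h₁ h₃ h hA W S μ).SK V c),
    ∃ Φ' : (pinT hHD hI h₁ h₃ h hA W S μ).SK V c,
      ((pinT hHD hI h₁ h₃ h hA W S μ).t34 V c).ϑ χ Φ = ((pinT hHD hI h₁ h₃ h hA W S μ).t34 V c).ϑ χ Φ' ∧
      ∃ (n : ℕ) (Γ' : Fin n → Level V)
        (Sit₂ : ∀ i, KTypeSituation ((𝕏).P 2) ((𝕏).ιinf (Γ' i)) ((𝕏).Δ (Γ' i)) (𝕏).κ₁ (𝕏).τ₁)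
        (j₂ : ∀ i, {j : (Sit₂ i).E →ₗ[ℂ] ((𝕏).P 2).weilDatum.ThetaTop // ((𝕏).P 2).kernelDatum.IsThetaEquivariant (Sit₂ i).κ (Sit₂ i).σ j})
        (Sit₃ : ∀ i, KTypeSituation ((𝕏).P 3) ((𝕏).ιinf (Γ' i)) ((𝕏).Δ (Γ' i)) (𝕏).κ₁ (𝕏).τ₁)
        (j₃ : ∀ i, {j : (Sit₃ i).E →ₗ[ℂ] ((𝕏).P 3).weilDatum.ThetaTop // ((𝕏).P 3).kernelDatum.IsThetaEquivariant (Sit₃ i).κ (Sit₃ i).σ j})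
        (φ₂ φ₃ : Fin n → Fin 2 → piSchwartzBruhat (𝕏).K (Fin 3)) (a : Fin n → ℂ),
        (∀ i, adm (Γ' i) 2 (Sit₂ i) ∧ j₂ i ∈ (Sit₂ i).𝓙 ∧ adm (Γ' i) 3 (Sit₃ i) ∧ j₃ i ∈ (Sit₃ i).𝓙) ∧
        (∀ i a', ((𝕏).P 2).weilDatum.toThetaTop (φ₂ i a') = (j₂ i).1 ((Sit₂ i).ι (LinearMap.proj a'))) ∧
        (∀ i a', ((𝕏).P 3).weilDatum.toThetaTop (φ₃ i a') = (j₃ i).1 ((Sit₃ i).ι (LinearMap.proj a'))) ∧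
        Φ'.1 = ∑ i, a i • (H.τ (φ₂ i 0) (φ₃ i 1) - H.τ (φ₂ i 1) (φ₃ i 0))

/-- **(K34) at `Real34Loc.ofThetaSat` from the character-wise datum** — as `gen_mem_ofThetaSat_of_kTypeDatum`, but the generator lands in the
SPAN of the wset itself (then in its closure by `Submodule.le_topologicalClosure`); no density, no continuity. -/
theorem Real34Loc.gen_mem_ofThetaSat_of_kTypeDatumT
    (hGfin : ∀ kf : V.adelicFin, finTranslate V hV kf ∈ (S V c).Gfin)
    (hcorr : ∀ (Γ : Level V), ∀ δ ∈ levelImage hHD hI h₁ h₃ Γ hV,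
      ∃ x : (V.latticeModel printFact_unitaryCompact_holds).G, x ∈ satLevelRegimeOf V hV Γ.K ∧
        (S V c).ιinf δ * x ∈ (V.latticeModel printFact_unitaryCompact_holds).Γ ∧ ∀ y : U21, Commute x ((S V c).ιinf y))
    (hW : IsAnisotropic L c.D.gramW) (H : SeesawHyp34 W S V c)
    (h2 : ((S V c).P 2).w = ⇑(archWeight L (μ c 2))) (h3 : ((S V c).P 3).w = ⇑(archWeight L (μ c 3)))
    (D : Real34KTypeDatumT hHD hI h₁ h₃ h hA W S μ V c hV H (adm₃₄ hHD hI h₁ h₃ (S V c) hV)) :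
    ∀ (χ : ((pinT hHD hI h₁ h₃ h hA W S μ).t34 V c).X) (Φ : (pinT hHD hI h₁ h₃ h hA W S μ).SK V c),
      ((pinT hHD hI h₁ h₃ h hA W S μ).t34 V c).ϑ χ Φ ∈
        (Submodule.span ℂ (Real34Loc.ofThetaSat hHD hI h₁ h₃ h hA W S μ V c hV hGfin hcorr).wset).topologicalClosure := by
  intro χ Φ
  obtain ⟨Φ', hϑ, n, Γ', Sit₂, j₂, Sit₃, j₃, φ₂, φ₃, a, hadm, hφ₂, hφ₃, hΦ1⟩ := D.hdecT χ Φ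
  rw [hϑ, t34_ϑ_eq_smul_sum_realise_wedge₂ hHD hI h₁ h₃ h hA W S μ V c hV hW H Γ' Sit₂ j₂ Sit₃ j₃ φ₂ φ₃ hφ₂ hφ₃ a χ Φ' hΦ1]
  refine Submodule.le_topologicalClosure _
    (Submodule.smul_mem _ _ (Submodule.sum_mem _ fun i _ => Submodule.smul_mem _ _ (Submodule.subset_span ?_)))
  have hχ := (mem_allowedChars _ _ _).1 χ.2
  exact (Real34Loc.ofThetaSat hHD hI h₁ h₃ h hA W S μ V c hV hGfin hcorr).realise_wedge₂_mem_wset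
    (Real34Loc.ofThetaSat_rep_thetaGenElt hHD hI h₁ h₃ h hA W S μ V c hV hGfin hcorr (Γ' i) 2 (Sit₂ i) (hadm i).1
      (j₂ i) (hadm i).2.1 (charFst χ.1)
      ((((S V c).P 2).residualType_iff_hasArchType_neg h2 (charFst χ.1)).2 (by simpa only [d34Of_m₁] using hχ.1)))
    (Real34Loc.ofThetaSat_rep_thetaGenElt hHD hI h₁ h₃ h hA W S μ V c hV hGfin hcorr (Γ' i) 3 (Sit₃ i) (hadm i).2.2.1
      (j₃ i) (hadm i).2.2.2 (charSnd χ.1)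
      ((((S V c).P 3).residualType_iff_hasArchType_neg h3 (charSnd χ.1)).2 (by simpa only [d34Of_m₂] using hχ.2)))

end Generic

/-! ## 2. At the total pins of record -/

namespace Gen12Pins

variable
  (hGR : ∀ {L : CMField} {ι₁ : L →+* ℂ} (V : HermSpace3 L ι₁) (c : SeesawCtx L),
    (cmSplittingDatum (L : Type) finProdFinEquiv (frameD V) (frameD_real V) (frameD_ne V) (dW c.D) (dW_real c.D)
      (dW_ne c.D)).CompatibleSplitting)
  (η : ∀ {L : CMField} {ι₁ : L →+* ℂ} (V : HermSpace3 L ι₁) (c : SeesawCtx L),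
    CMAdelic (L : Type) (frameD V) × CMAdelic (L : Type) (dW c.D) →* ℂˣ)
  (hη : ∀ {L : CMField} {ι₁ : L →+* ℂ} (V : HermSpace3 L ι₁) (c : SeesawCtx L),
    ∀ γU ∈ CMRat (L : Type) (frameD V), ∀ γ ∈ CMRat (L : Type) (dW c.D), η V c (γU, γ) = 1)
  (hηc : ∀ {L : CMField} {ι₁ : L →+* ℂ} (V : HermSpace3 L ι₁) (c : SeesawCtx L), Continuous fun p => ((η V c p : ℂˣ) : ℂ))
  (hGR₀ : ∀ {L : CMField} {ι₁ : L →+* ℂ} (V : HermSpace3 L ι₁) (c : SeesawCtx L),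
    (cmSplittingDatum (L : Type) (e₁) (frameD V) (frameD_real V) (frameD_ne V) (lineVec (L : Type) (dW c.D 0))
      (fun _ => dW_real c.D 0) (fun _ => dW_ne c.D 0)).CompatibleSplitting)
  (hGR₁ : ∀ {L : CMField} {ι₁ : L →+* ℂ} (V : HermSpace3 L ι₁) (c : SeesawCtx L),
    (cmSplittingDatum (L : Type) (e₁) (frameD V) (frameD_real V) (frameD_ne V) (lineVec (L : Type) (dW c.D 1))
      (fun _ => dW_real c.D 1) (fun _ => dW_ne c.D 1)).CompatibleSplitting)
  (hGR₂ : ∀ {L : CMField} {ι₁ : L →+* ℂ} (V : HermSpace3 L ι₁) (c : SeesawCtx L),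
    (cmSplittingDatum (L : Type) (e₁) (frameD V) (frameD_real V) (frameD_ne V) (lineVec (L : Type) (dW' c.D 0))
      (fun _ => dW'_real c.D 0) (fun _ => dW'_ne c.D 0)).CompatibleSplitting)
  (hGR₃ : ∀ {L : CMField} {ι₁ : L →+* ℂ} (V : HermSpace3 L ι₁) (c : SeesawCtx L),
    (cmSplittingDatum (L : Type) (e₁) (frameD V) (frameD_real V) (frameD_ne V) (lineVec (L : Type) (dW' c.D 1))
      (fun _ => dW'_real c.D 1) (fun _ => dW'_ne c.D 1)).CompatibleSplitting)
  (A : ∀ {L : CMField} {ι₁ : L →+* ℂ} (V : HermSpace3 L ι₁) (c : SeesawCtx L) (k : Fin 4),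
    ArchLineInput V (lineRepD V c.D (hGR V c) (hGR₀ V c) (hGR₁ V c) (hGR₂ V c) (hGR₃ V c) (η V c) k))

variable (hHD : exists_isReal_hodgeModel) (hI : hodgePQ_independent_of_hodgeModel)
  (h₁ : BallQuotientUniformised)  (h₃ : CMAbelianVarietyRealised)
  (h : Bool) (hA : Arapura2012_Cor_15_4_6) (μ : ∀ {L : CMField}, SeesawCtx L → Fin 4 → InfinitePlace L → ℤ)

/-- **C3 at the total pins from E's own binders** — for every type `i` and level `Γ`, the pinned theta classes lie in the
`(c.K, Ψ_i, σ)`-isotypic part, from `hLiu` (isotypy up to CM-inflation) and the CM-inflation fact `h31` (glue-1's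
`Model.thetaSub_of_fact`, E revision 8, at `W := Wg …`, `X := thetaSpaceInputOf … (SInstance.S …)`).  In particular the fields
`hU₂`/`hU₃` of #26's `Real34TotalResidual` are NOT independent hypotheses. -/
theorem hU_total (h31 : (picardCMUniverse hHD hI h₁ h₃).Fact_cmInflation)
    (hLiu : ∀ {L : CMField} {ι₁ : L →+* ℂ} (V : HermSpace3 L ι₁) (c : SeesawCtx L),
      (pinT hHD hI h₁ h₃ h hA (Wg @hGR @η @hη @hηc @τSyl @TSyl @hTSyl) (SInstance.S @hGR @η @hη @hηc @hGR₀ @hGR₁ @hGR₂ @hGR₃ @A) μ).GoodCtx ι₁ c → Module.finrank ℚ c.K = 6 →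
      ∀ (i : Fin 4) (Γ : Level V), ∃ (M : CMField) (k : c.K →+* M) (σ' : M →+* ℂ), σ'.comp k = c.σ ∧
        (pinT hHD hI h₁ h₃ h hA (Wg @hGR @η @hη @hηc @τSyl @TSyl @hTSyl) (SInstance.S @hGR @η @hη @hηc @hGR₀ @hGR₁ @hGR₂ @hGR₃ @A) μ).Theta V c i Γ ⊆
          (picardCMUniverse hHD hI h₁ h₃).Uiso Γ M (inflate k (c.Ψ i)) σ')
    {L : CMField} {ι₁ : L →+* ℂ} (V : HermSpace3 L ι₁) (c : SeesawCtx L)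
    (hc : (pinT hHD hI h₁ h₃ h hA (Wg @hGR @η @hη @hηc @τSyl @TSyl @hTSyl) (SInstance.S @hGR @η @hη @hηc @hGR₀ @hGR₁ @hGR₂ @hGR₃ @A) μ).GoodCtx ι₁ c) (hK : Module.finrank ℚ c.K = 6)
    (i : Fin 4) (Γ : Level V) :
    (pinT hHD hI h₁ h₃ h hA (Wg @hGR @η @hη @hηc @τSyl @TSyl @hTSyl) (SInstance.S @hGR @η @hη @hηc @hGR₀ @hGR₁ @hGR₂ @hGR₃ @A) μ).Theta V c i Γ ⊆
      (picardCMUniverse hHD hI h₁ h₃).Uiso Γ c.K (c.Ψ i) c.σ :=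
  thetaSub_of_fact hHD hI h₁ h₃ h hA (Wg @hGR @η @hη @hηc @τSyl @TSyl @hTSyl)
    (fun V c => thetaSpaceInputOf hHD hI h₁ h₃ (SInstance.S @hGR @η @hη @hηc @hGR₀ @hGR₁ @hGR₂ @hGR₃ @A) V c) μ h31 hLiu V c hc hK i Γ

/-- the regime of the W-plane at a good context of the pinned END STATE (binder-1-g6 `AdelicThetaCore.isAnisotropic_gramW_of_goodCtx`). -/
theorem hW_total {L : CMField} {ι₁ : L →+* ℂ} (c : SeesawCtx L)
    (hc : (pinT hHD hI h₁ h₃ h hA (Wg @hGR @η @hη @hηc @τSyl @TSyl @hTSyl) (SInstance.S @hGR @η @hη @hηc @hGR₀ @hGR₁ @hGR₂ @hGR₃ @A) μ).GoodCtx ι₁ c) :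
    IsAnisotropic L c.D.gramW :=
  AdelicThetaCore.isAnisotropic_gramW_of_goodCtx
    (pinC hHD hI h₁ h₃ hA (Wg @hGR @η @hη @hηc @τSyl @TSyl @hTSyl) (SInstance.S @hGR @η @hη @hηc @hGR₀ @hGR₁ @hGR₂ @hGR₃ @A)) h (d12Of μ) (d34Of μ)
    ((pinT_eq_thetaModel hHD hI h₁ h₃ h hA (Wg @hGR @η @hη @hηc @τSyl @TSyl @hTSyl) (SInstance.S @hGR @η @hη @hηc @hGR₀ @hGR₁ @hGR₂ @hGR₃ @A) μ) ▸ hc)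

section Context34

variable {L : CMField} {ι₁ : L →+* ℂ} (V : HermSpace3 L ι₁) (c : SeesawCtx L) (hV : IsAnisotropic L V.Hm)

/-- **(K34) at the total pins from the K-type datum**: `gen_mem` at the wset of the pinned record (on `hGfin_total hdef` and the (L3)
hypothesis `hcorr`) from the regime `hW`, the line-weight read-back `hAw` at `k = 2, 3` and ONE `Real34KTypeDatum` (at
`H := SeesawHyp34.ofTotal hdef`, `adm := adm₃₄`) — § 1 with `h2`/`h3 := (ST_P_w hdef k).trans (hAw k)`. -/
theorem gen_mem_totalK (hdef : (∀ j, 0 < (ι₁ (dW c.D j)).re) ∨ ∀ j, (ι₁ (dW c.D j)).re < 0)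
    (hcorr : ∀ (Γ : Level V), ∀ δ ∈ levelImage hHD hI h₁ h₃ Γ hV,
      ∃ x : (V.latticeModel printFact_unitaryCompact_holds).G, x ∈ satLevelRegimeOf V hV Γ.K ∧
        ((SInstance.S @hGR @η @hη @hηc @hGR₀ @hGR₁ @hGR₂ @hGR₃ @A) V c).ιinf δ * x ∈ (V.latticeModel printFact_unitaryCompact_holds).Γ ∧ ∀ y : U21, Commute x (((SInstance.S @hGR @η @hη @hηc @hGR₀ @hGR₁ @hGR₂ @hGR₃ @A) V c).ιinf y))
    (hW : IsAnisotropic L c.D.gramW) (hAw : ∀ k : Fin 4, k = 2 ∨ k = 3 → (A V c k).w = ⇑(archWeight L (μ c k)))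
    (D : Real34KTypeDatum hHD hI h₁ h₃ h hA (Wg @hGR @η @hη @hηc @τSyl @TSyl @hTSyl) (SInstance.S @hGR @η @hη @hηc @hGR₀ @hGR₁ @hGR₂ @hGR₃ @A) μ V c hV
      (SeesawHyp34.ofTotal @hGR @η @hη @hηc @hGR₀ @hGR₁ @hGR₂ @hGR₃ @A V c hdef)
      (adm₃₄ hHD hI h₁ h₃ ((SInstance.S @hGR @η @hη @hηc @hGR₀ @hGR₁ @hGR₂ @hGR₃ @A) V c) hV)) :
    ∀ (χ : ((pinT hHD hI h₁ h₃ h hA (Wg @hGR @η @hη @hηc @τSyl @TSyl @hTSyl) (SInstance.S @hGR @η @hη @hηc @hGR₀ @hGR₁ @hGR₂ @hGR₃ @A) μ).t34 V c).X)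
      (Φ : (pinT hHD hI h₁ h₃ h hA (Wg @hGR @η @hη @hηc @τSyl @TSyl @hTSyl) (SInstance.S @hGR @η @hη @hηc @hGR₀ @hGR₁ @hGR₂ @hGR₃ @A) μ).SK V c),
      ((pinT hHD hI h₁ h₃ h hA (Wg @hGR @η @hη @hηc @τSyl @TSyl @hTSyl) (SInstance.S @hGR @η @hη @hηc @hGR₀ @hGR₁ @hGR₂ @hGR₃ @A) μ).t34 V c).ϑ χ Φ ∈
        (Submodule.span ℂ (Real34Loc.ofThetaSat hHD hI h₁ h₃ h hA (Wg @hGR @η @hη @hηc @τSyl @TSyl @hTSyl) (SInstance.S @hGR @η @hη @hηc @hGR₀ @hGR₁ @hGR₂ @hGR₃ @A) μ V c hV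
          (hGfin_total @hGR @η @hη @hηc @hGR₀ @hGR₁ @hGR₂ @hGR₃ @A V c hV hdef) hcorr).wset).topologicalClosure :=
  Real34Loc.gen_mem_ofThetaSat_of_kTypeDatum hHD hI h₁ h₃ h hA (Wg @hGR @η @hη @hηc @τSyl @TSyl @hTSyl) (SInstance.S @hGR @η @hη @hηc @hGR₀ @hGR₁ @hGR₂ @hGR₃ @A) μ V c hV
    (hGfin_total @hGR @η @hη @hηc @hGR₀ @hGR₁ @hGR₂ @hGR₃ @A V c hV hdef) hcorr hW
    (SeesawHyp34.ofTotal @hGR @η @hη @hηc @hGR₀ @hGR₁ @hGR₂ @hGR₃ @A V c hdef)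
    ((ST_P_w @hGR @η @hη @hηc @hGR₀ @hGR₁ @hGR₂ @hGR₃ @A V c hdef 2).trans (hAw 2 (Or.inl rfl)))
    ((ST_P_w @hGR @η @hη @hηc @hGR₀ @hGR₁ @hGR₂ @hGR₃ @A V c hdef 3).trans (hAw 3 (Or.inr rfl))) D

end Context34

/-- **E's binder `real34` AT THE TOTAL PINS from the K-type datum** (quantified form).  Hypotheses: E's own `hpc hcup hph` (universe facts),
`h31` (CM-inflation) and `hLiu`; the line-weight read-back `hAw` at `k = 2, 3` (rfl at theta-3's (E1) pin, cf. #27 `hN1g_archLine`);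
the (L3) family `hcorr` (pin field of theta-3's RUN-38 (A); discharged in `Binders/Real34PinsTotalKR38`); and per good sextic context ONE
`Real34KTypeDatum` (the (K34) K-type content).  Proof: #26 `real34_total` at the residual record
`⟨hcorr, gen_mem_totalK …, hU_total … 2, hU_total … 3⟩`. -/
theorem real34_totalK (hpc : (picardCMUniverse hHD hI h₁ h₃).Fact_pull_comp)
    (hcup : (picardCMUniverse hHD hI h₁ h₃).Fact_pull_cup) (hph : (picardCMUniverse hHD hI h₁ h₃).Fact_pull_hodge)
    (h31 : (picardCMUniverse hHD hI h₁ h₃).Fact_cmInflation)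
    (hLiu : ∀ {L : CMField} {ι₁ : L →+* ℂ} (V : HermSpace3 L ι₁) (c : SeesawCtx L),
      (pinT hHD hI h₁ h₃ h hA (Wg @hGR @η @hη @hηc @τSyl @TSyl @hTSyl) (SInstance.S @hGR @η @hη @hηc @hGR₀ @hGR₁ @hGR₂ @hGR₃ @A) μ).GoodCtx ι₁ c → Module.finrank ℚ c.K = 6 →
      ∀ (i : Fin 4) (Γ : Level V), ∃ (M : CMField) (k : c.K →+* M) (σ' : M →+* ℂ), σ'.comp k = c.σ ∧
        (pinT hHD hI h₁ h₃ h hA (Wg @hGR @η @hη @hηc @τSyl @TSyl @hTSyl) (SInstance.S @hGR @η @hη @hηc @hGR₀ @hGR₁ @hGR₂ @hGR₃ @A) μ).Theta V c i Γ ⊆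
          (picardCMUniverse hHD hI h₁ h₃).Uiso Γ M (inflate k (c.Ψ i)) σ')
    (hAw : ∀ {L : CMField} {ι₁ : L →+* ℂ} (V : HermSpace3 L ι₁) (c : SeesawCtx L),
      (pinT hHD hI h₁ h₃ h hA (Wg @hGR @η @hη @hηc @τSyl @TSyl @hTSyl) (SInstance.S @hGR @η @hη @hηc @hGR₀ @hGR₁ @hGR₂ @hGR₃ @A) μ).GoodCtx ι₁ c →
        ∀ k : Fin 4, k = 2 ∨ k = 3 → (A V c k).w = ⇑(archWeight L (μ c k)))
    (hcorr : ∀ {L : CMField} {ι₁ : L →+* ℂ} (V : HermSpace3 L ι₁) (c : SeesawCtx L) (hV : IsAnisotropic L V.Hm),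
      ∀ (Γ : Level V), ∀ δ ∈ levelImage hHD hI h₁ h₃ Γ hV,
        ∃ x : (V.latticeModel printFact_unitaryCompact_holds).G, x ∈ satLevelRegimeOf V hV Γ.K ∧
          ((SInstance.S @hGR @η @hη @hηc @hGR₀ @hGR₁ @hGR₂ @hGR₃ @A) V c).ιinf δ * x ∈ (V.latticeModel printFact_unitaryCompact_holds).Γ ∧ ∀ y : U21, Commute x (((SInstance.S @hGR @η @hη @hηc @hGR₀ @hGR₁ @hGR₂ @hGR₃ @A) V c).ιinf y))
    (D : ∀ {L : CMField} {ι₁ : L →+* ℂ} (V : HermSpace3 L ι₁) (c : SeesawCtx L) (hV : IsAnisotropic L V.Hm)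
      (hc : (pinT hHD hI h₁ h₃ h hA (Wg @hGR @η @hη @hηc @τSyl @TSyl @hTSyl) (SInstance.S @hGR @η @hη @hηc @hGR₀ @hGR₁ @hGR₂ @hGR₃ @A) μ).GoodCtx ι₁ c), Module.finrank ℚ c.K = 6 →
        Real34KTypeDatum hHD hI h₁ h₃ h hA (Wg @hGR @η @hη @hηc @τSyl @TSyl @hTSyl) (SInstance.S @hGR @η @hη @hηc @hGR₀ @hGR₁ @hGR₂ @hGR₃ @A) μ V c hV
          (SeesawHyp34.ofTotal @hGR @η @hη @hηc @hGR₀ @hGR₁ @hGR₂ @hGR₃ @A V c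
            (planeDefinite_of_goodCtx @hGR @η @hη @hηc @hGR₀ @hGR₁ @hGR₂ @hGR₃ @A hHD hI h₁ h₃ h hA @μ c hc))
          (adm₃₄ hHD hI h₁ h₃ ((SInstance.S @hGR @η @hη @hηc @hGR₀ @hGR₁ @hGR₂ @hGR₃ @A) V c) hV))
    {L : CMField} {ι₁ : L →+* ℂ} (V : HermSpace3 L ι₁) (c : SeesawCtx L)
    (hc : (pinT hHD hI h₁ h₃ h hA (Wg @hGR @η @hη @hηc @τSyl @TSyl @hTSyl) (SInstance.S @hGR @η @hη @hηc @hGR₀ @hGR₁ @hGR₂ @hGR₃ @A) μ).GoodCtx ι₁ c) (hK : Module.finrank ℚ c.K = 6) :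
    Nonempty ((pinT hHD hI h₁ h₃ h hA (Wg @hGR @η @hη @hηc @τSyl @TSyl @hTSyl) (SInstance.S @hGR @η @hη @hηc @hGR₀ @hGR₁ @hGR₂ @hGR₃ @A) μ).Real34FunBridge V c) :=
  real34_total @hGR @η @hη @hηc @hGR₀ @hGR₁ @hGR₂ @hGR₃ @A hHD hI h₁ h₃ h hA @μ hpc hcup hph
    (fun V c hV hc hK =>
      { hcorr := hcorr V c hV
        gen_mem := gen_mem_totalK @hGR @η @hη @hηc @hGR₀ @hGR₁ @hGR₂ @hGR₃ @A hHD hI h₁ h₃ h hA @μ V c hV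
          (planeDefinite_of_goodCtx @hGR @η @hη @hηc @hGR₀ @hGR₁ @hGR₂ @hGR₃ @A hHD hI h₁ h₃ h hA @μ c hc) (hcorr V c hV)
          (hW_total @hGR @η @hη @hηc @hGR₀ @hGR₁ @hGR₂ @hGR₃ @A hHD hI h₁ h₃ h hA @μ c hc) (hAw V c hc) (D V c hV hc hK)
        hU₂ := fun Γ => hU_total @hGR @η @hη @hηc @hGR₀ @hGR₁ @hGR₂ @hGR₃ @A hHD hI h₁ h₃ h hA @μ h31 hLiu V c hc hK 2 Γ
        hU₃ := fun Γ => hU_total @hGR @η @hη @hηc @hGR₀ @hGR₁ @hGR₂ @hGR₃ @A hHD hI h₁ h₃ h hA @μ h31 hLiu V c hc hK 3 Γ })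
    V c hc hK

/-- **E's binder `real34` IN E's OWN TEXT at the total pins of record, from the K-type datum** (E's `hLiu` also in its own text). -/
theorem real34_totalKE (hpc : (picardCMUniverse hHD hI h₁ h₃).Fact_pull_comp)
    (hcup : (picardCMUniverse hHD hI h₁ h₃).Fact_pull_cup) (hph : (picardCMUniverse hHD hI h₁ h₃).Fact_pull_hodge)
    (h31 : (picardCMUniverse hHD hI h₁ h₃).Fact_cmInflation)
    (hLiu : ∀ {L : CMField} {ι₁ : L →+* ℂ} (V : HermSpace3 L ι₁) (c : SeesawCtx L),
      (thetaModelOf hHD hI h₁ h₃ h (embOf hHD hI h₁ h₃) (coverOf hHD hI h₁ h₃ hA) (wmOfInput (Wg @hGR @η @hη @hηc @τSyl @TSyl @hTSyl)) (thetaOf _ (thetaClassInputOf _ (fun V c => thetaSpaceInputOf hHD hI h₁ h₃ (SInstance.S @hGR @η @hη @hηc @hGR₀ @hGR₁ @hGR₂ @hGR₃ @A) V c))) (d12Of μ) (d34Of μ)).GoodCtx ι₁ c → Module.finrank ℚ c.K = 6 →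
      ∀ (i : Fin 4) (Γ : Level V), ∃ (M : CMField) (k : c.K →+* M) (σ' : M →+* ℂ), σ'.comp k = c.σ ∧
        (thetaModelOf hHD hI h₁ h₃ h (embOf hHD hI h₁ h₃) (coverOf hHD hI h₁ h₃ hA) (wmOfInput (Wg @hGR @η @hη @hηc @τSyl @TSyl @hTSyl)) (thetaOf _ (thetaClassInputOf _ (fun V c => thetaSpaceInputOf hHD hI h₁ h₃ (SInstance.S @hGR @η @hη @hηc @hGR₀ @hGR₁ @hGR₂ @hGR₃ @A) V c))) (d12Of μ) (d34Of μ)).Theta V c i Γ ⊆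
          (picardCMUniverse hHD hI h₁ h₃).Uiso Γ M (inflate k (c.Ψ i)) σ')
    (hAw : ∀ {L : CMField} {ι₁ : L →+* ℂ} (V : HermSpace3 L ι₁) (c : SeesawCtx L),
      (pinT hHD hI h₁ h₃ h hA (Wg @hGR @η @hη @hηc @τSyl @TSyl @hTSyl) (SInstance.S @hGR @η @hη @hηc @hGR₀ @hGR₁ @hGR₂ @hGR₃ @A) μ).GoodCtx ι₁ c →
        ∀ k : Fin 4, k = 2 ∨ k = 3 → (A V c k).w = ⇑(archWeight L (μ c k)))
    (hcorr : ∀ {L : CMField} {ι₁ : L →+* ℂ} (V : HermSpace3 L ι₁) (c : SeesawCtx L) (hV : IsAnisotropic L V.Hm),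
      ∀ (Γ : Level V), ∀ δ ∈ levelImage hHD hI h₁ h₃ Γ hV,
        ∃ x : (V.latticeModel printFact_unitaryCompact_holds).G, x ∈ satLevelRegimeOf V hV Γ.K ∧
          ((SInstance.S @hGR @η @hη @hηc @hGR₀ @hGR₁ @hGR₂ @hGR₃ @A) V c).ιinf δ * x ∈ (V.latticeModel printFact_unitaryCompact_holds).Γ ∧ ∀ y : U21, Commute x (((SInstance.S @hGR @η @hη @hηc @hGR₀ @hGR₁ @hGR₂ @hGR₃ @A) V c).ιinf y))
    (D : ∀ {L : CMField} {ι₁ : L →+* ℂ} (V : HermSpace3 L ι₁) (c : SeesawCtx L) (hV : IsAnisotropic L V.Hm)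
      (hc : (pinT hHD hI h₁ h₃ h hA (Wg @hGR @η @hη @hηc @τSyl @TSyl @hTSyl) (SInstance.S @hGR @η @hη @hηc @hGR₀ @hGR₁ @hGR₂ @hGR₃ @A) μ).GoodCtx ι₁ c), Module.finrank ℚ c.K = 6 →
        Real34KTypeDatum hHD hI h₁ h₃ h hA (Wg @hGR @η @hη @hηc @τSyl @TSyl @hTSyl) (SInstance.S @hGR @η @hη @hηc @hGR₀ @hGR₁ @hGR₂ @hGR₃ @A) μ V c hV
          (SeesawHyp34.ofTotal @hGR @η @hη @hηc @hGR₀ @hGR₁ @hGR₂ @hGR₃ @A V c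
            (planeDefinite_of_goodCtx @hGR @η @hη @hηc @hGR₀ @hGR₁ @hGR₂ @hGR₃ @A hHD hI h₁ h₃ h hA @μ c hc))
          (adm₃₄ hHD hI h₁ h₃ ((SInstance.S @hGR @η @hη @hηc @hGR₀ @hGR₁ @hGR₂ @hGR₃ @A) V c) hV)) :
    ∀ {L : CMField} {ι₁ : L →+* ℂ} (V : HermSpace3 L ι₁) (c : SeesawCtx L),
      (thetaModelOf hHD hI h₁ h₃ h (embOf hHD hI h₁ h₃) (coverOf hHD hI h₁ h₃ hA) (wmOfInput (Wg @hGR @η @hη @hηc @τSyl @TSyl @hTSyl))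
        (thetaOf _ (thetaClassInputOf _ (fun V c => thetaSpaceInputOf hHD hI h₁ h₃ (SInstance.S @hGR @η @hη @hηc @hGR₀ @hGR₁ @hGR₂ @hGR₃ @A) V c))) (d12Of μ) (d34Of μ)).GoodCtx ι₁ c →
      Module.finrank ℚ c.K = 6 →
      Nonempty ((thetaModelOf hHD hI h₁ h₃ h (embOf hHD hI h₁ h₃) (coverOf hHD hI h₁ h₃ hA) (wmOfInput (Wg @hGR @η @hη @hηc @τSyl @TSyl @hTSyl))
        (thetaOf _ (thetaClassInputOf _ (fun V c => thetaSpaceInputOf hHD hI h₁ h₃ (SInstance.S @hGR @η @hη @hηc @hGR₀ @hGR₁ @hGR₂ @hGR₃ @A) V c))) (d12Of μ) (d34Of μ)).Real34FunBridge V c) :=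
  fun V c hc hK => real34_totalK @hGR @η @hη @hηc @hGR₀ @hGR₁ @hGR₂ @hGR₃ @A hHD hI h₁ h₃ h hA @μ hpc hcup hph h31 hLiu hAw hcorr D V c hc hK


/-! ## 3′. The density-free, character-wise variant at the total pins -/

section Context34T

variable {L : CMField} {ι₁ : L →+* ℂ} (V : HermSpace3 L ι₁) (c : SeesawCtx L) (hV : IsAnisotropic L V.Hm)

/-- **(K34) at the total pins from the CHARACTER-WISE datum** (density-free twin of `gen_mem_totalK`): `gen_mem` at the wset of the pinned record (on `hGfin_total hdef` and the (L3)
hypothesis `hcorr`) from the regime `hW`, the line-weight read-back `hAw` at `k = 2, 3` and ONE `Real34KTypeDatumT` (at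
`H := SeesawHyp34.ofTotal hdef`, `adm := adm₃₄`) — § 1′ with `h2`/`h3 := (ST_P_w hdef k).trans (hAw k)`. -/
theorem gen_mem_totalKT (hdef : (∀ j, 0 < (ι₁ (dW c.D j)).re) ∨ ∀ j, (ι₁ (dW c.D j)).re < 0)
    (hcorr : ∀ (Γ : Level V), ∀ δ ∈ levelImage hHD hI h₁ h₃ Γ hV,
      ∃ x : (V.latticeModel printFact_unitaryCompact_holds).G, x ∈ satLevelRegimeOf V hV Γ.K ∧
        ((SInstance.S @hGR @η @hη @hηc @hGR₀ @hGR₁ @hGR₂ @hGR₃ @A) V c).ιinf δ * x ∈ (V.latticeModel printFact_unitaryCompact_holds).Γ ∧ ∀ y : U21, Commute x (((SInstance.S @hGR @η @hη @hηc @hGR₀ @hGR₁ @hGR₂ @hGR₃ @A) V c).ιinf y))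
    (hW : IsAnisotropic L c.D.gramW) (hAw : ∀ k : Fin 4, k = 2 ∨ k = 3 → (A V c k).w = ⇑(archWeight L (μ c k)))
    (DT : Real34KTypeDatumT hHD hI h₁ h₃ h hA (Wg @hGR @η @hη @hηc @τSyl @TSyl @hTSyl) (SInstance.S @hGR @η @hη @hηc @hGR₀ @hGR₁ @hGR₂ @hGR₃ @A) μ V c hV
      (SeesawHyp34.ofTotal @hGR @η @hη @hηc @hGR₀ @hGR₁ @hGR₂ @hGR₃ @A V c hdef)
      (adm₃₄ hHD hI h₁ h₃ ((SInstance.S @hGR @η @hη @hηc @hGR₀ @hGR₁ @hGR₂ @hGR₃ @A) V c) hV)) :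
    ∀ (χ : ((pinT hHD hI h₁ h₃ h hA (Wg @hGR @η @hη @hηc @τSyl @TSyl @hTSyl) (SInstance.S @hGR @η @hη @hηc @hGR₀ @hGR₁ @hGR₂ @hGR₃ @A) μ).t34 V c).X)
      (Φ : (pinT hHD hI h₁ h₃ h hA (Wg @hGR @η @hη @hηc @τSyl @TSyl @hTSyl) (SInstance.S @hGR @η @hη @hηc @hGR₀ @hGR₁ @hGR₂ @hGR₃ @A) μ).SK V c),
      ((pinT hHD hI h₁ h₃ h hA (Wg @hGR @η @hη @hηc @τSyl @TSyl @hTSyl) (SInstance.S @hGR @η @hη @hηc @hGR₀ @hGR₁ @hGR₂ @hGR₃ @A) μ).t34 V c).ϑ χ Φ ∈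
        (Submodule.span ℂ (Real34Loc.ofThetaSat hHD hI h₁ h₃ h hA (Wg @hGR @η @hη @hηc @τSyl @TSyl @hTSyl) (SInstance.S @hGR @η @hη @hηc @hGR₀ @hGR₁ @hGR₂ @hGR₃ @A) μ V c hV
          (hGfin_total @hGR @η @hη @hηc @hGR₀ @hGR₁ @hGR₂ @hGR₃ @A V c hV hdef) hcorr).wset).topologicalClosure :=
  Real34Loc.gen_mem_ofThetaSat_of_kTypeDatumT hHD hI h₁ h₃ h hA (Wg @hGR @η @hη @hηc @τSyl @TSyl @hTSyl) (SInstance.S @hGR @η @hη @hηc @hGR₀ @hGR₁ @hGR₂ @hGR₃ @A) μ V c hV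
    (hGfin_total @hGR @η @hη @hηc @hGR₀ @hGR₁ @hGR₂ @hGR₃ @A V c hV hdef) hcorr hW
    (SeesawHyp34.ofTotal @hGR @η @hη @hηc @hGR₀ @hGR₁ @hGR₂ @hGR₃ @A V c hdef)
    ((ST_P_w @hGR @η @hη @hηc @hGR₀ @hGR₁ @hGR₂ @hGR₃ @A V c hdef 2).trans (hAw 2 (Or.inl rfl)))
    ((ST_P_w @hGR @η @hη @hηc @hGR₀ @hGR₁ @hGR₂ @hGR₃ @A V c hdef 3).trans (hAw 3 (Or.inr rfl))) DT

end Context34T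


-- port_pkg: scope closed for this part
end Gen12Pins
end HodgeCM.Model
end
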